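import Summits.SmoothPoincare4.SmoothPoincare4.Theorems.DottedCircleRasmussenDcrGapHelperFriendsCarrierVkPartCChart

/-!
# Helper `helper_friendsCarrier_Vk_partC` (V_k part C: the collar of the uninverted model disc exterior) —
# piece 3: elementary computations, the presentation of `Y`, branch evaluation, `collarInv ∘ collar = id`
(item stmt-SmoothPoincare4-16128, route route-SmoothPoincare4-DottedCircleRasmussen)

Third piece of the port of the tree's `SliceDiscEndCollar.lean` to `M_k ⊂ ℝ⁴` (definitions in
`…VkPartCDatum`, flow chart and tube API in `…VkPartCChart`):

* elementary computations with the three collar formulas: the tube point `ptB ℓ r u v = G((1 - ℓ)u, r v)`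
  is the flow point `Φ(ℓ, ν(u, r v))` in the band `0 < ℓ < s₁` and is off the thin shell `Φ((0, s₀) × M_k)`
  for `ℓ ≥ s₀` (the template's `‖ptB‖ ≤ 1 - s₀`); the profile coordinates over a tube point; the two
  closed-form regimes of the profile `Ψ` of `SliceCollarProfile.lean`;
* the `Y`-side API of a smooth presentation `Q : V.Pres Y` (the T_k port's `Presentation` lemmas for the
  tube `ν`): `jB (p, v) = jM (ν(p̂, ‖p‖ v))` off the core circle, points off the `M_k`-part lie on the core
  circle, the three branches of `collar` and of `collarInv`;
* **`collarInv ∘ collar = id` on `Y × ℝ`** (`Pres.collarInv_collar`), branch by branch as in the template;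
* `helper_friendsCarrier_Vk_partC_leftInverse` — the registered summary: under the hypotheses of part C the
  collar `Y × ℝ → ℝ⁴` is injective.

Everything is proved; no definitions, no named facts, no `sorry`.
References: Manolescu–Piccirillo (2023), §3.2 [ManolescuPiccirillo2023]; Kirby (1989), Ch. I §5 [Kirby1989].
-/

-- the prescribed namespace `Summit.<P>.<Sub>.…` duplicates `SmoothPoincare4` (P = Sub)
set_option linter.dupNamespace false
set_option linter.style.longLine false

noncomputable section

open scoped Manifold ContDiff Topology
open Function Set Metric
open Literature.Topology.FourManifolds Literature.Topology.FourManifolds.MMSW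

namespace Summit.SmoothPoincare4.SmoothPoincare4.Theorems.DcrGap.MkFriends

namespace FriendsVk

namespace CollarDatum

variable {k : ℕ} (V : CollarDatum k)

/-! ### Elementary computations -/

/-- The flow formula of the disc tube at a nonzero disc coordinate in the band. [folklore] -/
theorem G_eq_Φ {x : EuclideanSpace ℝ (Fin 2)} (hx1 : 1 - V.s₁ < ‖x‖) (hx2 : ‖x‖ < 1) {w : EuclideanSpace ℝ (Fin 2)} (hw : ‖w‖ < 2) :
    V.G (x, w) = V.Φ (1 - ‖x‖, V.ν (radialProjection (spherePt 1) x, w)) := by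
  conv_lhs => rw [← norm_smul_coe_radialProjection (spherePt 1) x]
  exact V.cone _ _ _ hx1 hx2 hw

/-- The tube point in the band: `G ((1-ℓ) u, r v) = Φ (ℓ, ν (u, r v))` for `0 < ℓ < s₁`. [folklore] -/
theorem ptB_of_lt {ℓ r : ℝ} (hℓ0 : 0 < ℓ) (hℓ : ℓ < V.s₁) (hr : |r| < 2) (u v : Metric.sphere (0 : EuclideanSpace ℝ (Fin 2)) 1) :
    V.ptB ℓ r u v = V.Φ (ℓ, V.ν (u, r • (v : EuclideanSpace ℝ (Fin 2)))) := by
  rw [ptB, V.cone u (1 - ℓ) _ (by linarith) (by linarith) (by rwa [norm_smul, norm_eq_of_mem_sphere, mul_one, Real.norm_eq_abs]),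
    sub_sub_cancel]

/-- **The deep tube misses the thin shell** `Φ((0, s₀) × M_k)` (template: `‖G (x, w)‖ ≤ 1 - s₀`). [folklore] -/
theorem G_not_mem_shell {x w : EuclideanSpace ℝ (Fin 2)} (hx : ‖x‖ ≤ 1 - V.s₀) (hw : ‖w‖ < 2) : V.G (x, w) ∉ V.shell V.s₀ := by
  intro h
  obtain ⟨a, ha, s', hs'0, hs's, -, heq⟩ := V.exists_of_mem_shell h
  exact V.deep x w hx hw a ha s' hs'0 hs's heq.symm

/-- The tube point is off the thin shell for `ℓ ≥ s₀`. [folklore] -/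
theorem ptB_not_mem_shell {ℓ r : ℝ} (hℓ : V.s₀ ≤ ℓ) (hℓ1 : ℓ ≤ 1) (hr : |r| < 2) (u v : Metric.sphere (0 : EuclideanSpace ℝ (Fin 2)) 1) :
    V.ptB ℓ r u v ∉ V.shell V.s₀ :=
  V.G_not_mem_shell (by rw [norm_smul_coe_sphere (by linarith)]; linarith) (by rwa [norm_smul, norm_eq_of_mem_sphere, mul_one, Real.norm_eq_abs])

/-- The arguments of `ptB` lie in the domain for `0 < ℓ < 1`, `|r| < 2`. [folklore] -/
theorem ptB_arg_mem_dom {ℓ r : ℝ} (hℓ0 : 0 < ℓ) (hℓ1 : ℓ < 1) (hr : |r| < 2) (u v : Metric.sphere (0 : EuclideanSpace ℝ (Fin 2)) 1) :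
    (((1 - ℓ) • (u : EuclideanSpace ℝ (Fin 2)), r • (v : EuclideanSpace ℝ (Fin 2))) : (EuclideanSpace ℝ (Fin 2)) × (EuclideanSpace ℝ (Fin 2))) ∈
      (ConicalDiscTube.dom : Set ((EuclideanSpace ℝ (Fin 2)) × (EuclideanSpace ℝ (Fin 2)))) :=
  ConicalDiscTube.ptB_arg_mem_dom hℓ0 hℓ1 hr u v

/-- The tube coordinates of the tube point `ptB`. [folklore] -/
theorem Ginv_ptB {ℓ r : ℝ} (hℓ0 : 0 < ℓ) (hℓ1 : ℓ < 1) (hr : |r| < 2) (u v : Metric.sphere (0 : EuclideanSpace ℝ (Fin 2)) 1) :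
    V.Ginv (V.ptB ℓ r u v) = ((1 - ℓ) • (u : EuclideanSpace ℝ (Fin 2)), r • (v : EuclideanSpace ℝ (Fin 2))) :=
  V.Ginv_apply (ConicalDiscTube.ptB_arg_mem_dom hℓ0 hℓ1 hr u v)

/-- The tube point `ptB` lies in the tube neighbourhood. [folklore] -/
theorem ptB_mem_N {ℓ r : ℝ} (hℓ0 : 0 < ℓ) (hℓ1 : ℓ < 1) (hr : |r| < 2) (u v : Metric.sphere (0 : EuclideanSpace ℝ (Fin 2)) 1) : V.ptB ℓ r u v ∈ V.N :=
  ⟨_, ConicalDiscTube.ptB_arg_mem_dom hℓ0 hℓ1 hr u v, rfl⟩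

/-- The profile coordinates over the tube point `ν (u, w)`. [folklore] -/
theorem baseP_apply (u : Metric.sphere (0 : EuclideanSpace ℝ (Fin 2)) 1) (w : EuclideanSpace ℝ (Fin 2)) (σ : ℝ) :
    V.baseP (V.ν (u, w)) σ = SliceCollar.Ψinv V.s₀ (‖w‖, σ) := by
  rw [baseP, V.ι_ν]

/-- The profile coordinates over a tube point lie in the L-shaped domain. [folklore] -/
theorem baseP_mem {u : Metric.sphere (0 : EuclideanSpace ℝ (Fin 2)) 1} {w : EuclideanSpace ℝ (Fin 2)} (hw : w ≠ 0) (hw2 : ‖w‖ < 2) (σ : ℝ) :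
    V.baseP (V.ν (u, w)) σ ∈ SliceCollar.P V.s₀ := by
  rw [baseP_apply]; exact SliceCollar.Ψinv_mem V.s₀_pos V.depth₀_lt_one (ConicalDiscTube.mem_Strip hw hw2 σ)

/-- `Ψ (Ψ⁻¹ (‖w‖, σ)) = (‖w‖, σ)` over a tube point. [folklore] -/
theorem Ψ_baseP {u : Metric.sphere (0 : EuclideanSpace ℝ (Fin 2)) 1} {w : EuclideanSpace ℝ (Fin 2)} (hw : w ≠ 0) (hw2 : ‖w‖ < 2) (σ : ℝ) :
    SliceCollar.Ψ V.s₀ (V.baseP (V.ν (u, w)) σ) = (‖w‖, σ) := by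
  rw [baseP_apply]; exact SliceCollar.Ψ_Ψinv V.s₀_pos V.depth₀_lt_one (ConicalDiscTube.mem_Strip hw hw2 σ)

/-- The tube formula at `ν (u, w)` in terms of the profile coordinates. [folklore] -/
theorem cTube_apply (u : Metric.sphere (0 : EuclideanSpace ℝ (Fin 2)) 1) (w : EuclideanSpace ℝ (Fin 2)) (σ : ℝ) :
    V.cTube (V.ν (u, w)) σ = V.ptB (V.baseP (V.ν (u, w)) σ).1 (V.baseP (V.ν (u, w)) σ).2 u (radialProjection (spherePt 1) w) := by
  rw [cTube, V.ι_ν]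

/-- In `P s₀`, the image `τ ≤ 1` forces `r ≤ 1`. [folklore] -/
theorem snd_le_one_of_τ_le_one {p : ℝ × ℝ} (hp : p ∈ SliceCollar.P V.s₀) (h : (SliceCollar.Ψ V.s₀ p).1 ≤ 1) : p.2 ≤ 1 := by
  obtain ⟨-, -, h2, -, -⟩ := SliceCollar.mem_P_iff.1 hp
  by_contra hr
  rw [not_le] at hr
  have hτ : (SliceCollar.Ψ V.s₀ p).1 = SliceCollar.R p.2 := by rw [SliceCollar.Ψ_of_one_le V.s₀ h2 hr.le]
  have hR : 1 < SliceCollar.R p.2 := by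
    rw [← SliceCollar.R_of_one_le le_rfl]; exact SliceCollar.strictMono_R hr
  linarith

/-- In `P s₀`, the image `τ > 1` forces the right regime: `r ≥ 1`, `ℓ < s₀`, `Ψ = (r, -log E_{s₀} ℓ)`. [folklore] -/
theorem right_of_one_lt_τ {p : ℝ × ℝ} (hp : p ∈ SliceCollar.P V.s₀) (h : 1 < (SliceCollar.Ψ V.s₀ p).1) :
    1 ≤ p.2 ∧ p.1 < V.s₀ ∧ SliceCollar.Ψ V.s₀ p = (p.2, -Real.log (SliceCollar.E V.s₀ p.1)) := by
  obtain ⟨h0, -, h2, -, hor⟩ := SliceCollar.mem_P_iff.1 hp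
  have hr : 1 ≤ p.2 := by
    by_contra hr
    rw [not_le] at hr
    rcases lt_or_ge p.1 V.s₀ with hℓ | hℓ
    · linarith [(SliceCollar.τ_mem_of_corner h0 hℓ h2 hr).2, show (SliceCollar.Ψ V.s₀ p).1 = SliceCollar.τ V.s₀ p from rfl]
    · have := SliceCollar.τ_le_of_le V.s₀_pos h0 hℓ h2 hr
      have hT : SliceCollar.T V.s₀ < 1 := by rw [SliceCollar.T]; linarith [V.s₀_pos]
      linarith [show (SliceCollar.Ψ V.s₀ p).1 = SliceCollar.τ V.s₀ p from rfl]
  refine ⟨hr, hor.resolve_right (not_lt.2 hr), ?_⟩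
  rw [SliceCollar.Ψ_of_one_le V.s₀ h2 hr, SliceCollar.R_of_one_le hr]

/-- The shell formula is the flow point `Φ(ℓ, a)` at depth `ℓ = Einv s₀ e^{-σ} ∈ (0, s₀)`; its depth and drop. [folklore] -/
theorem depth_drop_cRad {a : EuclideanSpace ℝ (Fin 4)} (ha : a ∈ modelBoundary k) (σ : ℝ) :
    depth k (V.cRad a σ) = SliceCollar.Einv V.s₀ (Real.exp (-σ)) ∧ V.drop (V.cRad a σ) = a ∧ V.cRad a σ ∈ V.shell V.s₀ := by
  have hℓ := SliceCollar.Einv_mem V.s₀_pos (Real.exp (-σ))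
  have hℓ' : |SliceCollar.Einv V.s₀ (Real.exp (-σ))| < 2 * V.ε := by rw [abs_of_pos hℓ.1]; linarith [hℓ.2, V.s₀_lt_two]
  exact ⟨V.depth_Φ ha hℓ', V.drop_Φ ha hℓ', (V.Φ_mem_shell_iff ha hℓ' V.s₀).2 hℓ⟩

/-- The shell region lies in the thin shell; a point off the thin shell is not in the shell region. [folklore] -/
theorem not_mem_radSetT_of_not_mem_shell {z : EuclideanSpace ℝ (Fin 4)} (hz : z ∉ V.shell V.s₀) : z ∉ V.radSetT := fun h => hz h.1

/-! ### Branch evaluation of the inverse collar -/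

section InvBranches

variable {Y : Type*} {jM : EuclideanSpace ℝ (Fin 4) → Y} {jB : ↥solidTorus → Y}

/-- **Branch R'** of the inverse collar. [folklore] -/
theorem collarInv_of_mem_radSetT {z : EuclideanSpace ℝ (Fin 4)} (hz : z ∈ V.radSetT) : V.collarInv jM jB z = V.ΨRad jM z := by
  rw [collarInv, if_pos hz]

/-- **Branch P'** of the inverse collar. [folklore] -/
theorem collarInv_of_fst_ne_zero {z : EuclideanSpace ℝ (Fin 4)} (hz : z ∉ V.radSetT) (hx : (V.Ginv z).1 ≠ 0) :
    V.collarInv jM jB z = V.ΨTube jM z := by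
  rw [collarInv, if_neg hz, if_pos hx]

/-- **Branch F'** of the inverse collar. [folklore] -/
theorem collarInv_of_fst_eq_zero {z : EuclideanSpace ℝ (Fin 4)} (hz : z ∉ V.radSetT) (hx : (V.Ginv z).1 = 0) :
    V.collarInv jM jB z = V.ΨFlat jB z := by
  rw [collarInv, if_neg hz, if_neg (not_not.2 hx)]

end InvBranches

/-! ### The presentation of `Y`: branch evaluation of the collar -/

namespace Pres

variable {k : ℕ} {V : CollarDatum k} {Y : Type*} [TopologicalSpace Y] [ChartedSpace (EuclideanSpace ℝ (Fin 3)) Y] (Q : V.Pres Y)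

/-- `jB` is injective. [folklore] -/
theorem injective_jB : Injective Q.jB := Q.jB_emb.isEmbedding.injective

/-- `jM` is injective on `M_k ∖ K₁`. [folklore] -/
theorem injOn_jM : InjOn Q.jM {x : EuclideanSpace ℝ (Fin 4) | x ∈ modelBoundary k ∧ x ∉ range V.K₁} := fun x hx x' hx' h => by
  rw [← Q.ψ_jM x hx.1 hx.2, ← Q.ψ_jM x' hx'.1 hx'.2, h]

/-- `invB (jB b) = b`. [folklore] -/
theorem invB_jB (b : ↥solidTorus) : TubeNbhd.invB Q.jB (Q.jB b) = b := by
  rw [TubeNbhd.invB, Function.leftInverse_invFun Q.injective_jB b]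

/-- The core circle of the surgery solid torus is not in the `M_k`-part. [folklore] -/
theorem jB_zero_not_mem (v : Metric.sphere (0 : EuclideanSpace ℝ (Fin 2)) 1)
    (h : ((0 : EuclideanSpace ℝ (Fin 2)), v) ∈ solidTorus) : Q.jB ⟨((0 : EuclideanSpace ℝ (Fin 2)), v), h⟩ ∉ V.mSet Q.jM := by
  rintro ⟨a, ha, hab⟩
  obtain ⟨u, t, ht, hb, -⟩ := (Q.rel a ha.1 ha.2 _).1 hab
  exact smul_ne_zero ht.1.ne' (ne_zero_of_mem_unit_sphere u) hb.symm

/-- A point of the solid torus off its core circle is in the `M_k`-part: `jB (p, v) = jM (ν(p̂, ‖p‖ v))`. [folklore] -/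
theorem jB_eq_jM (b : ↥solidTorus) (hb : (b : EuclideanSpace ℝ (Fin 2) × Metric.sphere (0 : EuclideanSpace ℝ (Fin 2)) 1).1 ≠ 0) :
    Q.jB b = Q.jM (V.ν (radialProjection (spherePt 1) (b : EuclideanSpace ℝ (Fin 2) × Metric.sphere (0 : EuclideanSpace ℝ (Fin 2)) 1).1,
      ‖(b : EuclideanSpace ℝ (Fin 2) × Metric.sphere (0 : EuclideanSpace ℝ (Fin 2)) 1).1‖ •
        ((b : EuclideanSpace ℝ (Fin 2) × Metric.sphere (0 : EuclideanSpace ℝ (Fin 2)) 1).2 : EuclideanSpace ℝ (Fin 2)))) := by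
  have hlt : ‖(b : EuclideanSpace ℝ (Fin 2) × Metric.sphere (0 : EuclideanSpace ℝ (Fin 2)) 1).1‖ < 1 := (mem_solidTorus_iff _).1 b.2
  have hpos : 0 < ‖(b : EuclideanSpace ℝ (Fin 2) × Metric.sphere (0 : EuclideanSpace ℝ (Fin 2)) 1).1‖ := norm_pos_iff.2 hb
  symm
  rw [Q.rel _ (V.ν_mem _) (V.ν_smul_not_mem_range hpos.ne' _ _)]
  exact ⟨_, _, ⟨hpos, hlt⟩, (norm_smul_coe_radialProjection _ _).symm, rfl⟩

/-- A point of the solid torus off its core circle is in the `M_k`-part. [folklore] -/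
theorem jB_mem_mSet (b : ↥solidTorus) (hb : (b : EuclideanSpace ℝ (Fin 2) × Metric.sphere (0 : EuclideanSpace ℝ (Fin 2)) 1).1 ≠ 0) :
    Q.jB b ∈ V.mSet Q.jM := by
  rw [Q.jB_eq_jM b hb]
  exact ⟨_, ⟨V.ν_mem _, V.ν_smul_not_mem_range (norm_pos_iff.2 hb).ne' _ _⟩, rfl⟩

/-- A point of `Y` outside the `M_k`-part lies on the core circle of the surgery solid torus. [folklore] -/
theorem eq_jB_zero_of_not_mem {y : Y} (hy : y ∉ V.mSet Q.jM) :
    ∃ (v : Metric.sphere (0 : EuclideanSpace ℝ (Fin 2)) 1) (h : ((0 : EuclideanSpace ℝ (Fin 2)), v) ∈ solidTorus),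
      Q.jB ⟨((0 : EuclideanSpace ℝ (Fin 2)), v), h⟩ = y := by
  have hcov := Q.cover ▸ mem_univ y
  rcases hcov with hy' | ⟨b, rfl⟩
  · exact absurd hy' hy
  · have hb : (b : EuclideanSpace ℝ (Fin 2) × Metric.sphere (0 : EuclideanSpace ℝ (Fin 2)) 1).1 = 0 := by
      by_contra h; exact hy (Q.jB_mem_mSet b h)
    refine ⟨(b : EuclideanSpace ℝ (Fin 2) × Metric.sphere (0 : EuclideanSpace ℝ (Fin 2)) 1).2, ?_, ?_⟩
    · simp [mem_solidTorus_iff]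
    · congr 1; ext1
      exact Prod.ext hb.symm rfl

/-- `jM a ∈ radSet` iff `a` is outside the closed unit tube (`a ∈ M_k ∖ K₁`). [folklore] -/
theorem jM_mem_radSet_iff {a : EuclideanSpace ℝ (Fin 4)} (ha : a ∈ modelBoundary k) (ha' : a ∉ range V.K₁) :
    Q.jM a ∈ V.radSet Q.jM ↔ a ∉ V.unitTube := by
  constructor
  · rintro ⟨a', ⟨ha'1, ha'2⟩, h⟩
    rw [Q.injOn_jM ⟨ha'1, fun hm => ha'2 (V.range_subset_unitTube hm)⟩ ⟨ha, ha'⟩ h] at ha'2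
    exact ha'2
  · exact fun h => ⟨a, ⟨ha, h⟩, rfl⟩

/-- **Branch R**: outside the closed unit tube the collar is the shell formula. [folklore] -/
theorem collar_of_not_mem_unitTube {a : EuclideanSpace ℝ (Fin 4)} (ha : a ∈ modelBoundary k) (hat : a ∉ V.unitTube) (σ : ℝ) :
    V.collar Q.jM Q.jB Q.ψ (Q.jM a, σ) = V.cRad a σ := by
  have ha' : a ∉ range V.K₁ := fun h => hat (V.range_subset_unitTube h)
  rw [CollarDatum.collar, if_pos ((Q.jM_mem_radSet_iff ha ha').2 hat), Q.ψ_jM a ha ha']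

/-- **Branch P**: on the closed unit tube (off the knot) the collar is the tube formula. [folklore] -/
theorem collar_of_mem_unitTube {a : EuclideanSpace ℝ (Fin 4)} (ha : a ∈ modelBoundary k) (ha' : a ∉ range V.K₁)
    (hat : a ∈ V.unitTube) (σ : ℝ) : V.collar Q.jM Q.jB Q.ψ (Q.jM a, σ) = V.cTube a σ := by
  rw [CollarDatum.collar, if_neg (fun h => (Q.jM_mem_radSet_iff ha ha').1 h hat), if_pos ⟨a, ⟨ha, ha'⟩, rfl⟩, Q.ψ_jM a ha ha']

/-- **Branch F**: over the core circle of the surgery solid torus the collar is the flat formula. [folklore] -/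
theorem collar_of_core (v : Metric.sphere (0 : EuclideanSpace ℝ (Fin 2)) 1) (h : ((0 : EuclideanSpace ℝ (Fin 2)), v) ∈ solidTorus) (σ : ℝ) :
    V.collar Q.jM Q.jB Q.ψ (Q.jB ⟨((0 : EuclideanSpace ℝ (Fin 2)), v), h⟩, σ) = V.cFlat ((0 : EuclideanSpace ℝ (Fin 2)), v) σ := by
  have h1 := Q.jB_zero_not_mem v h
  have h2 : Q.jB ⟨((0 : EuclideanSpace ℝ (Fin 2)), v), h⟩ ∉ V.radSet Q.jM := by
    rintro ⟨a, ⟨ha, hat⟩, hab⟩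
    exact h1 ⟨a, ⟨ha, fun hm => hat (V.range_subset_unitTube hm)⟩, hab⟩
  rw [CollarDatum.collar, if_neg h2, if_neg h1, Q.invB_jB]

/-! ### `collarInv ∘ collar = id` -/

/-- **Branch R**: `collarInv (collar (jM a, σ)) = (jM a, σ)` outside the closed unit tube. [folklore] -/
theorem collarInv_collar_rad {a : EuclideanSpace ℝ (Fin 4)} (ha : a ∈ modelBoundary k) (hat : a ∉ V.unitTube) (σ : ℝ) :
    V.collarInv Q.jM Q.jB (V.collar Q.jM Q.jB Q.ψ (Q.jM a, σ)) = (Q.jM a, σ) := by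
  obtain ⟨hdepth, hdrop, hshell⟩ := V.depth_drop_cRad ha σ
  rw [Q.collar_of_not_mem_unitTube ha hat]
  have hmem : V.cRad a σ ∈ V.radSetT := ⟨hshell, by rw [hdrop]; exact hat⟩
  rw [V.collarInv_of_mem_radSetT hmem, CollarDatum.ΨRad, hdrop, hdepth, SliceCollar.E_Einv _ (Real.exp_pos _), Real.log_exp, neg_neg]

/-- **Branch P**: `collarInv (collar (jM a, σ)) = (jM a, σ)` over the closed unit tube, off the knot. [folklore] -/
theorem collarInv_collar_tube {a : EuclideanSpace ℝ (Fin 4)} (ha' : a ∉ range V.K₁) (hat : a ∈ V.unitTube) (σ : ℝ) :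
    V.collarInv Q.jM Q.jB (V.collar Q.jM Q.jB Q.ψ (Q.jM a, σ)) = (Q.jM a, σ) := by
  -- write `a = ν (u, w)` with `0 < ‖w‖ ≤ 1`
  obtain ⟨⟨u, w⟩, ⟨-, hw1⟩, hqa⟩ := hat
  rw [mem_closedBall, dist_zero_right] at hw1
  have ha : a ∈ modelBoundary k := hqa ▸ V.ν_mem _
  have hw : w ≠ 0 := fun h => ha' (by rw [← hqa, h, V.ν_zero]; exact mem_range_self u)
  have hwpos : 0 < ‖w‖ := norm_pos_iff.2 hw
  have hw2 : ‖w‖ < 2 := by linarith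
  have haeq : a = V.ν (u, w) := hqa.symm
  set p := V.baseP (V.ν (u, w)) σ with hp
  have hP : p ∈ SliceCollar.P V.s₀ := V.baseP_mem hw hw2 σ
  obtain ⟨hℓ0, hℓ1, hr0, hr2, hor⟩ := SliceCollar.mem_P_iff.1 hP
  have hΨ : SliceCollar.Ψ V.s₀ p = (‖w‖, σ) := V.Ψ_baseP hw hw2 σ
  have hr2' : |p.2| < 2 := by rw [abs_of_pos hr0]; exact hr2
  have hr1 : p.2 ≤ 1 := V.snd_le_one_of_τ_le_one hP (by rw [hΨ]; exact hw1)
  rw [Q.collar_of_mem_unitTube ha ha' ⟨(u, w), ⟨mem_univ _, by simpa using hw1⟩, hqa⟩, haeq, V.cTube_apply]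
  -- the collar point is not in the shell region
  have hnot : V.ptB p.1 p.2 u (radialProjection (spherePt 1) w) ∉ V.radSetT := by
    rcases lt_or_ge p.1 V.s₀ with hℓ | hℓ
    · rintro ⟨-, hdir⟩
      have hs : |p.1| < 2 * V.ε := by rw [abs_of_pos hℓ0]; linarith [V.s₀_lt_two]
      rw [V.ptB_of_lt hℓ0 (hℓ.trans V.s₀_lt) hr2', V.drop_Φ (V.ν_mem _) hs, V.mem_unitTube_iff, norm_smul_coe_sphere hr0.le] at hdir
      exact hdir hr1
    · exact V.not_mem_radSetT_of_not_mem_shell (V.ptB_not_mem_shell hℓ hℓ1.le hr2' _ _)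
  have hGinv := V.Ginv_ptB hℓ0 hℓ1 hr2' u (radialProjection (spherePt 1) w)
  have hx0 : (V.Ginv (V.ptB p.1 p.2 u (radialProjection (spherePt 1) w))).1 ≠ 0 := by
    rw [hGinv]; exact smul_ne_zero (by linarith) (ne_zero_of_mem_unit_sphere u)
  rw [V.collarInv_of_fst_ne_zero hnot hx0, CollarDatum.ΨTube, CollarDatum.profB, hGinv]
  simp only
  rw [norm_smul_coe_sphere (by linarith), norm_smul_coe_sphere hr0.le, sub_sub_cancel, show (p.1, p.2) = p from rfl, hΨ,
    radialProjection_smul _ (by linarith : (0 : ℝ) < 1 - p.1), radialProjection_smul _ hr0]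
  refine Prod.ext ?_ rfl
  show Q.jM (V.ν (u, ‖w‖ • ((radialProjection (spherePt 1) w : Metric.sphere (0 : EuclideanSpace ℝ (Fin 2)) 1) : EuclideanSpace ℝ (Fin 2)))) = Q.jM (V.ν (u, w))
  rw [norm_smul_coe_radialProjection]

/-- **Branch F**: `collarInv (collar (y, σ)) = (y, σ)` on the core circle of the surgery torus. [folklore] -/
theorem collarInv_collar_core (v : Metric.sphere (0 : EuclideanSpace ℝ (Fin 2)) 1) (h : ((0 : EuclideanSpace ℝ (Fin 2)), v) ∈ solidTorus) (σ : ℝ) :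
    V.collarInv Q.jM Q.jB (V.collar Q.jM Q.jB Q.ψ (Q.jB ⟨((0 : EuclideanSpace ℝ (Fin 2)), v), h⟩, σ)) = (Q.jB ⟨((0 : EuclideanSpace ℝ (Fin 2)), v), h⟩, σ) := by
  have hr := SliceCollar.Einv_mem one_pos (Real.exp (-σ))
  rw [Q.collar_of_core v h, CollarDatum.cFlat]
  simp only [smul_zero]
  have hnv : ‖SliceCollar.Einv 1 (Real.exp (-σ)) • (v : EuclideanSpace ℝ (Fin 2))‖ = SliceCollar.Einv 1 (Real.exp (-σ)) :=
    norm_smul_coe_sphere hr.1.le _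
  have hdom : (((0 : EuclideanSpace ℝ (Fin 2)), SliceCollar.Einv 1 (Real.exp (-σ)) • (v : EuclideanSpace ℝ (Fin 2))) :
      (EuclideanSpace ℝ (Fin 2)) × (EuclideanSpace ℝ (Fin 2))) ∈ (ConicalDiscTube.dom : Set ((EuclideanSpace ℝ (Fin 2)) × (EuclideanSpace ℝ (Fin 2)))) :=
    ConicalDiscTube.mem_dom_iff.2 ⟨by simp, by rw [hnv]; linarith [hr.2]⟩
  have hnot : V.G ((0 : EuclideanSpace ℝ (Fin 2)), SliceCollar.Einv 1 (Real.exp (-σ)) • (v : EuclideanSpace ℝ (Fin 2))) ∉ V.radSetT :=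
    V.not_mem_radSetT_of_not_mem_shell (V.G_not_mem_shell (by simp; linarith [V.depth₀_lt_one]) (by rw [hnv]; linarith [hr.2]))
  have hGinv := V.Ginv_apply hdom
  rw [V.collarInv_of_fst_eq_zero hnot (by rw [hGinv]), CollarDatum.ΨFlat, hGinv]
  simp only [smul_zero]
  rw [radialProjection_smul _ hr.1, hnv, SliceCollar.E_Einv _ (Real.exp_pos _), Real.log_exp, neg_neg]
  refine Prod.ext ?_ rfl
  exact TubeNbhd.jBt_of_norm_lt Q.jB (by simp)

/-- **`collarInv ∘ collar = id` on `Y × ℝ`.** [folklore] -/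
theorem collarInv_collar (p : Y × ℝ) : V.collarInv Q.jM Q.jB (V.collar Q.jM Q.jB Q.ψ p) = p := by
  obtain ⟨y, σ⟩ := p
  by_cases hy : y ∈ V.mSet Q.jM
  · obtain ⟨a, ⟨ha, ha'⟩, rfl⟩ := hy
    by_cases hat : a ∈ V.unitTube
    · exact Q.collarInv_collar_tube ha' hat σ
    · exact Q.collarInv_collar_rad ha hat σ
  · obtain ⟨v, h, rfl⟩ := Q.eq_jB_zero_of_not_mem hy
    exact Q.collarInv_collar_core v h σ

/-- The collar is injective. [folklore] -/
theorem collar_injective : Injective (V.collar Q.jM Q.jB Q.ψ) :=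
  fun p p' h => by rw [← Q.collarInv_collar p, ← Q.collarInv_collar p', h]

end Pres

/-- **The smooth presentation assembled from the `Y`-side hypothesis block of `helper_friendsCarrier_Vk_partC`.** [folklore] -/
theorem Pres.ofHyp_spec {Y : Type*} [TopologicalSpace Y] [ChartedSpace (EuclideanSpace ℝ (Fin 3)) Y]
    {jB : ↥solidTorus → Y} {jM : EuclideanSpace ℝ (Fin 4) → Y} {W : Set (EuclideanSpace ℝ (Fin 4))} {ψ : Y → EuclideanSpace ℝ (Fin 4)}
    (h1 : Manifold.IsSmoothEmbedding (𝓘(ℝ, EuclideanSpace ℝ (Fin 2)).prod (𝓡 1)) (𝓡 3) ∞ jB) (h2 : IsOpen (range jB)) (h8 : IsOpen W)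
    (h9 : ∀ x ∈ modelBoundary k, x ∉ range V.K₁ → x ∈ W)
    (h10 : ContMDiffOn 𝓘(ℝ, EuclideanSpace ℝ (Fin 4)) (𝓡 3) ∞ jM W)
    (h11 : IsOpen (jM '' {x : EuclideanSpace ℝ (Fin 4) | x ∈ modelBoundary k ∧ x ∉ range V.K₁}))
    (h12 : ContMDiffOn (𝓡 3) 𝓘(ℝ, EuclideanSpace ℝ (Fin 4)) ∞ ψ (jM '' {x : EuclideanSpace ℝ (Fin 4) | x ∈ modelBoundary k ∧ x ∉ range V.K₁}))
    (h13 : ∀ x ∈ modelBoundary k, x ∉ range V.K₁ → ψ (jM x) = x)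
    (h14 : jM '' {x : EuclideanSpace ℝ (Fin 4) | x ∈ modelBoundary k ∧ x ∉ range V.K₁} ∪ range jB = univ)
    (h15 : ∀ x ∈ modelBoundary k, x ∉ range V.K₁ → ∀ b : ↥solidTorus, jM x = jB b ↔
      ∃ (u : Metric.sphere (0 : EuclideanSpace ℝ (Fin 2)) 1) (t : ℝ), t ∈ Ioo (0 : ℝ) 1 ∧
        b.1.1 = t • (u : EuclideanSpace ℝ (Fin 2)) ∧ x = V.ν (u, t • (b.1.2 : EuclideanSpace ℝ (Fin 2)))) :
    ∃ Q : V.Pres Y, Q.jM = jM ∧ Q.jB = jB ∧ Q.ψ = ψ :=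
  ⟨{ jM := jM, jB := jB, W := W, ψ := ψ, jB_emb := h1, isOpen_range_jB := h2, isOpen_W := h8, mem_W := h9, contMDiffOn_jM := h10,
     isOpen_mSet := h11, contMDiffOn_ψ := h12, ψ_jM := h13, cover := h14, rel := h15 }, rfl, rfl, rfl⟩

end CollarDatum

end FriendsVk

/-- **Helper `helper_friendsCarrier_Vk_partC_leftInverse`** (registered piece 3 of
`helper_friendsCarrier_Vk_partC`, line `mk_friends`, crux `DcrGap`): under the hypotheses of part C, the collar
`c : Y × ℝ → ℝ⁴` of the uninverted model disc exterior — shell formula `Φ(ℓ, a)`, tube formula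
`G((1 - ℓ)u, r ŵ)`, flat formula `G(4p, Einv 1 e^{-σ} v)` on the three parts of `Y` — has a left inverse,
in particular it is INJECTIVE, and its core loop is the tube meridian: `c(jB(0, v), 0) = G(0, v/2)`
(Kirby 1989, Ch. I §5; Manolescu–Piccirillo 2023, §3.2). [cite: Kirby1989, Ch. I §5] -/
theorem helper_friendsCarrier_Vk_partC_leftInverse : ∀ (k : ℕ) (K₁ : (sphere (0 : EuclideanSpace ℝ (Fin 2)) 1) → EuclideanSpace ℝ (Fin 4)) (Φ : ℝ × EuclideanSpace ℝ (Fin 4) → EuclideanSpace ℝ (Fin 4)) (ε s₁ s₀ : ℝ) (g : EuclideanSpace ℝ (Fin 2) → EuclideanSpace ℝ (Fin 4)) (G : EuclideanSpace ℝ (Fin 2) × EuclideanSpace ℝ (Fin 2) → EuclideanSpace ℝ (Fin 4)) (ν : (sphere (0 : EuclideanSpace ℝ (Fin 2)) 1) × EuclideanSpace ℝ (Fin 2) → EuclideanSpace ℝ (Fin 4)), IsModelKnot k K₁ → ContDiff ℝ ∞ Φ → (∀ x, Φ (0, x) = x) → (∀ s t x, Φ (s, Φ (t, x)) = Φ (s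 + t, x)) → 0 < ε → ε ≤ 1 / 4 → (∀ x ∈ modelBoundary k, ∀ s : ℝ, |s| ≤ 2 * ε → (∀ j, (1 : ℝ) / 2 < holeTerm k j (Φ (s, x))) ∧ levelFun k (Φ (s, x)) = 1 + s) → (∀ y, (∀ j, 0 < holeTerm k j y) → |levelFun k y - 1| < 2 * ε → Φ (1 - levelFun k y, y) ∈ modelBoundary k) → 0 < s₀ → s₀ < s₁ → s₁ < 2 * ε → IsModelSliceDisc k K₁ g → (∀ (u : (sphere (0 : EuclideanSpace ℝ (Fin 2)) 1)) (t : ℝ), 1 - s₁ ≤ t → t ≤ 1 → g (t • (u : EuclideanSpace ℝ (Fin 2))) = Φ (1 - t, K₁ u)) → (ContDiffOn ℝ ∞ G (ball 0 1 ×ˢ ball 0 2) ∧ InjOn G (ball 0 1 ×ˢ ball 0 2) ∧ (∀ q ∈ ball 0 1 ×ˢ ball 0 2, Injective (fderiv ℝ G q)) ∧ (∀ q ∈ ball 0 1 ×ˢ ball 0 2, G q ∉ modelHandlebody k) ∧ (∀ x ∈ ball 0 1, G (x, 0) = g x)) → (∀ (u : (sphere (0 : EuclideanSpace ℝ (Fin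 2)) 1)) (t : ℝ) (w : EuclideanSpace ℝ (Fin 2)), 1 - s₁ < t → t < 1 → ‖w‖ < 2 → G (t • (u : EuclideanSpace ℝ (Fin 2)), w) = Φ (1 - t, ν (u, w))) → (∀ (x w : EuclideanSpace ℝ (Fin 2)), ‖x‖ ≤ 1 - s₀ → ‖w‖ < 2 → ∀ a ∈ modelBoundary k, ∀ s : ℝ, 0 < s → s < s₀ → G (x, w) ≠ Φ (s, a)) → ∀ (Y : Type) [TopologicalSpace Y] [T2Space Y] [SecondCountableTopology Y] [ChartedSpace (EuclideanSpace ℝ (Fin 3)) Y] [IsManifold (𝓡 3) ∞ Y] (jB : solidTorus → Y) (jM : EuclideanSpace ℝ (Fin 4) → Y) (W : Set (EuclideanSpace ℝ (Fin 4))) (ψ : Y → EuclideanSpace ℝ (Fin 4)), (Manifold.IsSmoothEmbedding (𝓘(ℝ, EuclideanSpace ℝ (Fin 2)).prod (𝓡 1)) (𝓡 3) ∞ jB ∧ IsOpen (range jB) ∧ ContMDiff ((𝓡 1).prod 𝓘(ℝ, EuclideanSpace ℝ (Fin 2))) 𝓘(ℝ, EuclideanSpace ℝ (Fin 4)) ∞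 ν ∧ Injective ν ∧ (∀ p, Injective (mfderiv ((𝓡 1).prod 𝓘(ℝ, EuclideanSpace ℝ (Fin 2))) 𝓘(ℝ, EuclideanSpace ℝ (Fin 4)) ν p)) ∧ (∀ p, ν p ∈ modelBoundary k) ∧ (∀ u : (sphere (0 : EuclideanSpace ℝ (Fin 2)) 1), ν (u, 0) = K₁ u) ∧ IsOpen W ∧ (∀ x ∈ modelBoundary k, x ∉ range K₁ → x ∈ W) ∧ ContMDiffOn 𝓘(ℝ, EuclideanSpace ℝ (Fin 4)) (𝓡 3) ∞ jM W ∧ IsOpen (jM '' {x : EuclideanSpace ℝ (Fin 4) | x ∈ modelBoundary k ∧ x ∉ range K₁}) ∧ ContMDiffOn (𝓡 3) 𝓘(ℝ, EuclideanSpace ℝ (Fin 4)) ∞ ψ (jM '' {x : EuclideanSpace ℝ (Fin 4) | x ∈ modelBoundary k ∧ x ∉ range K₁}) ∧ (∀ x ∈ modelBoundary k, x ∉ range K₁ → ψ (jM x) = x) ∧ jM '' {x : EuclideanSpace ℝ (Fin 4) | x ∈ modelBoundary k ∧ x ∉ range K₁} ∪ range jB = univ ∧ (∀ x ∈ modelBoundary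 k, x ∉ range K₁ → ∀ b : solidTorus, jM x = jB b ↔ ∃ (u : (sphere (0 : EuclideanSpace ℝ (Fin 2)) 1)) (t : ℝ), t ∈ Ioo (0 : ℝ) 1 ∧ b.1.1 = t • (u : EuclideanSpace ℝ (Fin 2)) ∧ x = ν (u, t • (b.1.2 : EuclideanSpace ℝ (Fin 2))))) → ∃ c : Y × ℝ → EuclideanSpace ℝ (Fin 4), Injective c ∧ ∀ (v : (sphere (0 : EuclideanSpace ℝ (Fin 2)) 1)) (b : solidTorus), b.1 = (0, v) → c (jB b, 0) = G (0, (1 / 2 : ℝ) • (v : EuclideanSpace ℝ (Fin 2))) := by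
  intro k K₁ Φ ε s₁ s₀ g G ν hK hΦ hΦ0 hΦadd hε hε4 hclock hband hs₀ hs₀₁ hs₁ε hg hgcone hG hGcone hdeep Y _ _ _ _ _ jB jM W ψ
    ⟨h1, h2, h3, h4, h5, h6, h7, h8, h9, h10, h11, h12, h13, h14, h15⟩
  let V : FriendsVk.CollarDatum k :=
    FriendsVk.CollarDatum.datumOf hK hΦ hΦ0 hΦadd hε hε4 hclock hband hs₀ hs₀₁ hs₁ε hg hgcone hG hGcone hdeep h3 h4 h5 h6 h7
  obtain ⟨Q, hQM, hQB, hQψ⟩ := FriendsVk.CollarDatum.Pres.ofHyp_spec V h1 h2 h8 h9 h10 h11 h12 h13 h14 h15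
  refine ⟨V.collar Q.jM Q.jB Q.ψ, Q.collar_injective, fun v b hb => ?_⟩
  have hsolid : ((0 : EuclideanSpace ℝ (Fin 2)), v) ∈ solidTorus := by simp [mem_solidTorus_iff]
  have hb' : b = ⟨((0 : EuclideanSpace ℝ (Fin 2)), v), hsolid⟩ := Subtype.ext hb
  have hψ1 : TraceCollar.ψinv 1 = 1 := by
    rw [TraceCollar.ψinv, Real.log_one]; norm_num
  rw [hb', ← hQB, Q.collar_of_core v hsolid 0, FriendsVk.CollarDatum.cFlat]
  simp only [smul_zero, neg_zero, Real.exp_zero]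
  rw [SliceCollar.Einv, hψ1]
  norm_num
  rfl

end Summit.SmoothPoincare4.SmoothPoincare4.Theorems.DcrGap.MkFriends

end
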